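import Summits.ResolutionOfSingularities.ResolutionOfSingularities.Theorems.HilbertSamuelEliminationSigmaMaxModificationsCorridor3WLadderIsoInsepTailCutDefs
import HarnessLib

/-!
# [OURS · L1 W4.2] k2 PART 4 — the PINNED COUNTDOWN of the `e_κ = 1` cell of `T3insep` at `p = 2` (E1 = (γ) of res-L1-w42-plan-1 RULING v3.14-10):
# `twoDelta`, the pinned transform, the rows `TwoDeltaStepLaw₂` / `TwoDeltaNearLaw₂` / `PinnedTowerExtraction₂`, and the PROVED join
# `isoInsepE1Impossible₂_of_rows : PinnedTowerExtraction₂ 3 → IsoInsepE0Impossible₂ 3 → IsoInsepE1Impossible₂ 3`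
# (crux chain w42, cell k2; typer pass of res-L1-w42-idea-1 Sketch C8 §8; `--supports stmt-ResolutionOfSingularities-19249`)

OURS (cell res-hironaka, slot W4.2, seat res-D-pv-042); NOT a statement of [Hironaka2017] nor of [CossartJannsenSaito2020] / [CossartPiltant2009].
AI-drafted, weaker than expert review. TYPER PASS: the statements below are copied VERBATIM (names, binders, docstrings, proofs; ONE typing change: `PinnedTowerExtraction₂` gets the
level parameter `(N : ℕ)`, see its docstring) from
res-L1-w42-idea-1's `Sketch-L1-idea-1-C8.lean` sha16 9bc0d6b6f2802a6f §8 «THE PINNED COUNTDOWN of the `e_κ = 1` cell ((γ); card C8 K2)», re-homed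
into the tree namespace `IdeasL1C6` of k2 PART 2′ (`…Corridor3WLadderIsoInsepCellsDefs`, p529700: `IsFormalDoublePointAt`, the E-cut rows
`IsoInsepE0Impossible₂` / `IsoInsepE1Impossible₂`, whose docstring already points here: «PROVED from the rows `PinnedTowerExtraction₂` and
`TwoDeltaStepLaw₂`, `isoInsepE1Impossible₂_of_rows` — a separate object») and PART 3a (`…Corridor3WLadderIsoInsepTailCutDefs`, p540282).  Every
`def … : Prop` row is an OURS ROW (an obligation, not a fact); the two theorems are the sketch's own proofs.

* tokens `uDeg`, `pinWeight`, `twoDelta` (twice Hironaka's `δ(F; x,y,z; w)` of the `ℝ¹`-polyhedron in the GIVEN coordinates), `pinnedTransform`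
  (`u ↦ u w`, divide by `w²`), `IsEOneShape`;
* rows `TwoDeltaStepLaw₂` (the countdown `2δ ↦ 2δ − 2` at a forced step), `TwoDeltaNearLaw₂` (`x′` near ⇔ `4 ≤ twoDelta F`), `PinnedTowerExtraction₂`
  (an `e_κ = 1` stage of an isolated E3 point tower over a maximal origin of characteristic two, with E0 excluded, extracts a pinned formal
  sequence `F (k+1) = pinnedTransform (F k)` with `twoDelta (F 0) < ⊤` and `4 < twoDelta (F k)` for all `k`);
* PROVED `degree_eq_uDeg_add`, `twoDelta_pinnedTransform_add_two_le` (the half of the step law the countdown uses) and the join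
  `isoInsepE1Impossible₂_of_rows` (universe `0`, level `N = 3`, the kernel's).

References (pointers only, nothing attributed): [CossartPiltant2009, ch. 3 I.10 (Dis)]; [CossartJannsenSaito2020, Ch. 7–9 (polyhedra, pointer)].
-/

noncomputable section

set_option linter.dupNamespace false

open scoped Classical
open CategoryTheory AlgebraicGeometry TopologicalSpace IsLocalRing MvPowerSeries
open Summit.ResolutionOfSingularities.ResolutionOfSingularities.Theorems.CampaignW42
open Literature.AlgebraicGeometry.Resolution Literature.AlgebraicGeometry.CossartJannsenSaito2020
open Summit.ResolutionOfSingularities.ResolutionOfSingularities.Cruxes.SigmaMaxModifications.IdeasL1Idea2R4 (IsIsoPointTower)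
open Summit.ResolutionOfSingularities.ResolutionOfSingularities.Cruxes.SigmaMaxModifications.IdeasL1C5 (IsInsepStage)

namespace Summit.ResolutionOfSingularities.ResolutionOfSingularities.Cruxes.SigmaMaxModifications.IdeasL1C6

/-! ## §8. THE PINNED COUNTDOWN of the `e_κ = 1` cell ((γ); card C8 K2) -/

section Pinned

variable {κ : Type} [Field κ]

/-- the `u`-degree `e₀ + e₁ + e₂` of an exponent (`u = (x,y,z) = (X₀,X₁,X₂)`, free variable `w = X₃`). -/
def uDeg (e : Fin 4 →₀ ℕ) : ℕ := e 0 + e 1 + e 2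

/-- [OURS] the pinned weight of an exponent of `u`-degree `≤ 1`: `l` for `w^l`, `2l` for `u_s w^l` (twice the `ℝ¹`-polyhedron abscissa
`l/(2 − uDeg)`). -/
def pinWeight (e : Fin 4 →₀ ℕ) : ℕ := if uDeg e = 0 then e 3 else 2 * e 3

/-- [OURS] **`twoDelta F`** = twice Hironaka's `δ(F; x,y,z; w) ∈ ½ℕ ∪ {∞}` of the `ℝ¹`-polyhedron `Δ(F; u; w) = [δ, ∞)` in the GIVEN
coordinates: the least pinned weight of a monomial of `u`-degree `≤ 1` present in `F` (`⊤` iff `F ∈ (x,y,z)²`, i.e. the `w`-axis is a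
curve of multiplicity `≥ 2` of `F` — excluded at an ISOLATED point after preparation, see `PinnedTowerExtraction₂`). [folklore] -/
noncomputable def twoDelta (F : MvPowerSeries (Fin 4) κ) : ℕ∞ :=
  ⨅ (e : Fin 4 →₀ ℕ) (_ : uDeg e ≤ 1) (_ : F e ≠ 0), (pinWeight e : ℕ∞)

/-- [OURS] the PINNED TRANSFORM `F'(u', w) = F(u'·w, w)/w²` (the `w`-chart of the point blow-up at the pinned near point `(0:0:0:1)`, no
translation — the near point is `κ`-rational and unique by §6): the coefficient of `u'^a w^l` in `F'` is the coefficient of `u^a w^{l+2−|a|}`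
in `F` (zero if `l + 2 < |a|`). Meaningful for `ord F ≥ 2`. [folklore] -/
noncomputable def pinnedTransform (F : MvPowerSeries (Fin 4) κ) : MvPowerSeries (Fin 4) κ :=
  fun e => if uDeg e ≤ e 3 + 2 then F (e.update 3 (e 3 + 2 - uDeg e)) else 0

/-- [OURS] `F` has the `e_κ = 1` SHAPE w.r.t. `(λ, μ)`: `F = x² + λy² + μz² + R` with `ord R ≥ 3`. (Pinning needs `{λ, μ}` 2-independent,
carried separately as the existence of the normalised coefficient derivations.) [folklore] -/
def IsEOneShape (lam mu : κ) (F : MvPowerSeries (Fin 4) κ) : Prop :=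
  ∃ R : MvPowerSeries (Fin 4) κ, (3 : ℕ∞) ≤ R.order ∧ F = X 0 ^ 2 + C lam * X 1 ^ 2 + C mu * X 2 ^ 2 + R

/-- [OURS · LAW (S; coefficient chasing, provable)] **THE STEP LAW**: for `ord F ≥ 2` the pinned transform lowers `twoDelta` by EXACTLY `2`
(`w^l ↦ w^{l−2}`, `u_s w^l ↦ u'_s w^{l−1}`; the `u`-degree is preserved, so the `u`-degree-`≤ 1` part of `F'` is the transform of that of `F`). -/
def TwoDeltaStepLaw₂ : Prop :=
  ∀ (κ : Type) (_ : Field κ) (F : MvPowerSeries (Fin 4) κ), (2 : ℕ∞) ≤ F.order → twoDelta (pinnedTransform F) + 2 = twoDelta F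

/-- [OURS · LAW (S; coefficient chasing, provable)] **THE NEAR LAW**: for `ord F ≥ 2`, the origin of the pinned chart is NEAR (`ord F' ≥ 2`) iff
`4 ≤ twoDelta F` (a monomial `u^a w^l` lands in degree `2|a| + l − 2 ≤ 1` iff `(|a|, l) ∈ {(0, ≤ 3), (1, ≤ 1)}` iff its pinned weight is `≤ 3`). -/
def TwoDeltaNearLaw₂ : Prop :=
  ∀ (κ : Type) (_ : Field κ) (F : MvPowerSeries (Fin 4) κ), (2 : ℕ∞) ≤ F.order →
    ((2 : ℕ∞) ≤ (pinnedTransform F).order ↔ (4 : ℕ∞) ≤ twoDelta F)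

omit [Field κ] in
/-- total degree of an exponent on `Fin 4` = `u`-degree + `w`-exponent. -/
theorem degree_eq_uDeg_add (e : Fin 4 →₀ ℕ) : e.degree = uDeg e + e 3 := by
  have h : e.degree = ∑ i, e i := by
    simp only [Finsupp.degree, AddMonoidHom.coe_mk, ZeroHom.coe_mk]
    exact Finset.sum_subset (Finset.subset_univ _) fun i _ hi => by simpa using hi
  rw [h, Fin.sum_univ_four]
  rfl

/-- [OURS · PROVED · the half of the STEP LAW that the countdown uses] for `ord F ≥ 2` the pinned transform lowers `twoDelta` by AT LEAST
`2`: every monomial `u^a w^l` of `u`-degree `≤ 1` present in `F` (necessarily `|a| + l ≥ 2`) reappears in `F'` as `u'^a w^{l − 2 + |a|}`, of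
pinned weight exactly `2` less. (The reverse inequality — no NEW low monomials — is the other half of `TwoDeltaStepLaw₂`; not needed below.) -/
theorem twoDelta_pinnedTransform_add_two_le (F : MvPowerSeries (Fin 4) κ) (hF : (2 : ℕ∞) ≤ F.order) :
    twoDelta (pinnedTransform F) + 2 ≤ twoDelta F := by
  classical
  refine le_iInf fun e => le_iInf fun hu => le_iInf fun hne => ?_
  have hdeg : 2 ≤ uDeg e + e 3 := by
    by_contra hlt
    push Not at hlt
    apply hne
    have h : (e.degree : ℕ∞) < F.order := by
      refine lt_of_lt_of_le ?_ hF
      rw [degree_eq_uDeg_add]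
      exact_mod_cast hlt
    exact MvPowerSeries.coeff_of_lt_order h
  set e' : Fin 4 →₀ ℕ := e.update 3 (e 3 - (2 - uDeg e)) with he'
  have h0' : e' 0 = e 0 := by simp [he']
  have h1' : e' 1 = e 1 := by simp [he']
  have h2' : e' 2 = e 2 := by simp [he']
  have hu' : uDeg e' = uDeg e := by simp only [uDeg, h0', h1', h2']
  have h3' : e' 3 = e 3 - (2 - uDeg e) := by simp [he']
  have hback : e'.update 3 (e' 3 + 2 - uDeg e') = e := by
    ext i
    by_cases hi : i = 3
    · subst hi
      simp only [Finsupp.coe_update, Function.update_self, h3', hu']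
      omega
    · simp [he', hi]
  have hval : pinnedTransform F e' = F e := by
    show (if uDeg e' ≤ e' 3 + 2 then F (e'.update 3 (e' 3 + 2 - uDeg e')) else 0) = F e
    rw [if_pos (by rw [hu', h3']; omega), hback]
  have hne' : pinnedTransform F e' ≠ 0 := by rw [hval]; exact hne
  have hw : (pinWeight e' : ℕ∞) + 2 = pinWeight e := by
    unfold pinWeight
    rw [hu', h3']
    split_ifs with h0
    · norm_cast; omega
    · norm_cast; omega
  have hle : twoDelta (pinnedTransform F) ≤ (pinWeight e' : ℕ∞) := by
    unfold twoDelta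
    exact iInf_le_of_le e' (iInf_le_of_le (hu'.le.trans hu) (iInf_le _ hne'))
  calc twoDelta (pinnedTransform F) + 2 ≤ (pinWeight e' : ℕ∞) + 2 := by gcongr
    _ = pinWeight e := hw

/-- [OURS · L1 W4.2 · C8 · DICTIONARY ROW (γ)] **PINNED-TOWER EXTRACTION**: in an isolated E3 point tower (level 3) over a maximal origin
of characteristic two with NO `e_κ = 0` double-point stages (§7 E0), an inseparable double-point stage `n` with `e_κ = 1` yields a
coefficient field `κ` and equations `F_k ∈ κ⟦x,y,z,w⟧` of the stages `n + k` (`k ≥ 0`) in PREPARED pinned coordinates such that: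
`twoDelta F₀ < ⊤` (preparation = dissolving the solvable vertex `c·w^{2δ}`, `c ∈ κ² + λκ² + μκ²`, by `u ↦ u + γw^δ`; it terminates at an
ISOLATED point, else `F ∈ (ũ)²` after a formal coordinate change and the `w̃`-axis is a multiplicity-2 curve of `X(ν)^` through `x` —
isolation transfers to the completion by excellence, lead-1's H8), every `F_{k+1}` is the pinned transform of `F_k` (§6: `AC = {u = 0}` pins
the unique near point at the `κ`-rational origin of the `w`-chart; the residue field never grows; preparedness is inherited because the step
maps the initial weight part bijectively, `c·w^{2δ} ↦ c·w^{2δ−2}`), `ord F_k ≥ 2` (near), and `4 < twoDelta F_k` (at `twoDelta = 4` the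
successor's initial form is `Q(u') + ℓ(u')·w + c·w²` with `ℓ ≠ 0` — then `ē ≤ 2`, not a stage — or `c ∉ κ² + λκ² + μκ²` — then `e_κ = 0`,
excluded by E0; at `twoDelta ≤ 3` the origin is not near). Why it might fail: the three glue items named (AC pinning dictionary, preparation
finiteness under isolation + excellence, the `twoDelta = 4` boundary); nothing else — the countdown itself is `TwoDeltaStepLaw₂`.
(pointers, nothing attributed: CJS LNM 2270 Thm. 3.14, Rem. 18.29). OURS row — an
obligation of this line, NOT a citation of print.  TYPING NOTE (res-D-pv-042): the sketch states the row at the kernel's level `N = 3`; it is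
typed here at every level `N` (the origin `IsMaximalOrigin 2 N`, the tower `IsIsoPointTower N`), VERBATIM otherwise, and the join below uses
`PinnedTowerExtraction₂ 3` — a parameterless `Prop` in a Theorems file is read by the gate as an inline named fact and relocated. [folklore] -/
def PinnedTowerExtraction₂ (N : ℕ) : Prop :=
  ∀ (ν : ℕ → ℕ) (T : BlowupTower.{0}) (pt : ∀ n, T.X n) (n : ℕ), IsMaximalOrigin 2 N ν (T.X 0) (pt 0) → IsIsoPointTower N ν T pt →
    (∀ m, IsInsepStage T pt m → IsFormalDoublePointAt (T.X m) (pt m) → @Scheme.dirDim (T.X m) (T.ln m) (pt m) ≠ 0) →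
    IsInsepStage T pt n → IsFormalDoublePointAt (T.X n) (pt n) → @Scheme.dirDim (T.X n) (T.ln n) (pt n) = 1 →
      ∃ (κ : Type) (_ : Field κ) (_ : CharP κ 2) (F : ℕ → MvPowerSeries (Fin 4) κ),
        twoDelta (F 0) < ⊤ ∧ ∀ k, F (k + 1) = pinnedTransform (F k) ∧ (2 : ℕ∞) ≤ (F k).order ∧ (4 : ℕ∞) < twoDelta (F k)

/-- [OURS · PROVED · (γ) CLOSED MODULO ONE DICTIONARY ROW (and E0)] an `ℕ∞`-valued quantity that is finite at the first pinned stage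
cannot drop by at least `2` at every step for ever. Uses only the PROVED half `twoDelta_pinnedTransform_add_two_le` of the step law. Hence
`IsoInsepE1Impossible₂ 3` (universe `0`, the kernel's) from `PinnedTowerExtraction₂` and `IsoInsepE0Impossible₂ 3`. -/
theorem isoInsepE1Impossible₂_of_rows (hX : PinnedTowerExtraction₂ 3) (h0 : IsoInsepE0Impossible₂.{0} 3) :
    IsoInsepE1Impossible₂.{0} 3 := by
  intro ν T pt hO hT n hins hd h1
  obtain ⟨κ, _, _, F, hfin, hF⟩ := hX ν T pt n hO hT (h0 ν T pt hO hT) hins hd h1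
  have hstep : ∀ k, twoDelta (F (k + 1)) + 2 ≤ twoDelta (F k) := by
    intro k
    obtain ⟨hFk, hord, _⟩ := hF k
    rw [hFk]
    exact twoDelta_pinnedTransform_add_two_le (F k) hord
  -- `twoDelta (F k)` is finite for every `k`
  have hne : ∀ k, twoDelta (F k) ≠ ⊤ := by
    intro k
    induction k with
    | zero => exact hfin.ne
    | succ k ih =>
      intro htop
      have h := hstep k
      rw [htop, top_add, top_le_iff] at h
      exact ih h
  -- pass to `ℕ`
  have hd : ∀ k, ((twoDelta (F k)).toNat : ℕ∞) = twoDelta (F k) := fun k => ENat.coe_toNat (hne k)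
  have hrel : ∀ k, (twoDelta (F (k + 1))).toNat + 2 ≤ (twoDelta (F k)).toNat := by
    intro k
    have h := hstep k
    rw [← hd (k + 1), ← hd k] at h
    exact_mod_cast h
  have hsum : ∀ k, (twoDelta (F k)).toNat + 2 * k ≤ (twoDelta (F 0)).toNat := by
    intro k
    induction k with
    | zero => simp
    | succ k ih => have := hrel k; omega
  have hbig := hsum ((twoDelta (F 0)).toNat + 1)
  omega

end Pinned

end Summit.ResolutionOfSingularities.ResolutionOfSingularities.Cruxes.SigmaMaxModifications.IdeasL1C6

end
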